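import Summits.NavierStokesRegularity.NavierStokesRegularity.Theorems.CircuitTrace.Negative.LoadBearing

/-!
# `CircuitTrace` (stmt-NavierStokesRegularity-1836), line `tilted-trace-gronwall`:
# the quiet-valve budget (stub S1, `stub_valveBudget`) NEEDS cyclic cancellation (4.3)

Negative-side support (drefute seat). `ValveBudgetWithoutCyclic` is the lead's registered stub
`stub_valveBudget` (skeleton `Cruxes/CircuitTrace/Lines/tilted-trace-gronwall.lean`, da3ad81a) with the
single hypothesis `IsCyclic coeff` deleted, everything else verbatim. It is FALSE:
for the symmetric but non-cyclic pure self-interaction circuit `coeff = [μ = none]` (`m = 1`) the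
steady state `X₁ ≡ lam^{-1/5}` (critical amplitude exactly `1`, all other modes `0`) solves the
circuit for all time, the valve `n = 0` is empty (hence `δ`-quiet for every `δ`), the mode above it is
`δ`-active forever, and `δ² lam^{4/5} (t₂ - t₁)` is unbounded in the window length. So the budget's
constant `C` is paid for by energy conservation of the nonlinearity (`trilinear_cancel`) and by nothing
else in the hypothesis list: any proof of S1 must route through (4.3). (Symmetry (4.2) does hold for the
witness, so adding `IsSymm` would not rescue the cyclic-free variant.)

No statement here asserts a `Theses` decl positively. [folklore]
-/

noncomputable section

set_option linter.dupNamespace false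

namespace Summit.NavierStokesRegularity.NavierStokesRegularity.Theorems.CircuitTrace.Negative

open Finset Real Set

/-- Stub S1 (`stub_valveBudget`) of line `tilted-trace-gronwall` with `IsCyclic coeff →` deleted. -/
def ValveBudgetWithoutCyclic : Prop :=
  ∀ lam : ℝ, 1 < lam → ∀ (m : ℕ) (coeff : Fin m → Fin m → Fin m → Option (Fin 3) → ℝ),
    ∀ A : ℝ, ∃ δ₀ : ℝ, 0 < δ₀ ∧ ∃ C : ℝ, ∀ δ : ℝ, 0 < δ → δ ≤ δ₀ →
    ∀ (T : ℝ) (X : Fin m → ℤ → ℝ → ℝ), 0 < T →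
    (∀ (i : Fin m) (n : ℤ), ∀ t ∈ Set.Ioo 0 T, HasDerivAt (X i n) (circuitRHS lam coeff X i n t) t) →
    (∀ (i : Fin m) (n : ℤ) (t : ℝ), n < 0 → X i n t = 0) →
    (∀ T' ∈ Set.Ioo 0 T, ∃ C : ℝ, ∀ (i : Fin m) (n : ℤ), ∀ t ∈ Set.Icc 0 T',
      lam ^ ((4 : ℝ) * n) * |X i n t| ≤ C) →
    (∀ t ∈ Set.Ico 0 T, ∀ (i : Fin m) (n : ℤ), lam ^ ((1 / 5 : ℝ) * n) * |X i n t| ≤ A) →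
    ∀ n : ℤ, 0 ≤ n → ∀ t₁ t₂ : ℝ, 0 < t₁ → t₁ ≤ t₂ → t₂ < T →
    (∀ i : Fin m, ∀ t ∈ Set.Icc t₁ t₂, lam ^ ((1 / 5 : ℝ) * n) * |X i n t| ≤ δ) →
    (∀ t ∈ Set.Icc t₁ t₂, ∃ (i : Fin m) (j : ℤ), n < j ∧ δ ≤ lam ^ ((1 / 5 : ℝ) * j) * |X i j t|) →
    δ ^ 2 * lam ^ ((4 / 5 : ℝ) * (n + 1)) * (t₂ - t₁) ≤ C

/-- Pure self-interaction structure constants (`m = 1`): `coeff(μ) = [μ = none]`, i.e. the circuit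
`Ẋ_n = -lam^{4n/5} X_n + lam^n X_n²` at every scale, with no inter-scale coupling. -/
def selfCoeff : Fin 1 → Fin 1 → Fin 1 → Option (Fin 3) → ℝ :=
  fun _ _ _ μ => if μ = none then 1 else 0

/-- The self-interaction constants obey Tao's symmetry condition (4.2). -/
theorem selfCoeff_symm : IsSymm selfCoeff := by
  intro i₁ i₂ i₃ μ
  rcases μ with _ | a <;> simp [selfCoeff]

/-- The self-interaction constants violate the cyclic cancellation condition (4.3). -/
theorem selfCoeff_not_cyclic : ¬ IsCyclic selfCoeff := by
  intro h
  have h0 := h (fun _ => 0) none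
  simp only [selfCoeff, Option.map_none, if_true, Finset.sum_const, Finset.card_univ,
    Fintype.card_perm, Fintype.card_fin, nsmul_eq_mul, mul_one] at h0
  norm_num [Nat.factorial] at h0

/-- With the self-interaction constants the circuit right-hand side is the scalar logistic-type law. -/
theorem circuitRHS_selfCoeff (lam : ℝ) (X : Fin 1 → ℤ → ℝ → ℝ) (i : Fin 1) (n : ℤ) (t : ℝ) :
    circuitRHS lam selfCoeff X i n t =
      -(lam ^ ((4 / 5 : ℝ) * n)) * X i n t + lam ^ (n : ℝ) * X 0 n t * X 0 n t := by
  have hi : i = 0 := Subsingleton.elim _ _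
  subst hi
  unfold circuitRHS selfCoeff
  simp

/-- The steady witness: critical amplitude `1` parked at scale `1`, nothing elsewhere. -/
def steadyX (lam : ℝ) : Fin 1 → ℤ → ℝ → ℝ := fun _ n _ => if n = 1 then lam ^ (-(1 / 5 : ℝ)) else 0

/-- **S1 needs (4.3).** The cyclic-free valve budget is false. -/
theorem valveBudget_false_without_cyclic : ¬ ValveBudgetWithoutCyclic := by
  intro h
  obtain ⟨δ₀, hδ₀, C, hC⟩ := h 2 (by norm_num) 1 selfCoeff 1
  have h2 : (0 : ℝ) < 2 := by norm_num
  set δ : ℝ := min δ₀ 1 with hδdef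
  have hδ : 0 < δ := lt_min hδ₀ one_pos
  have hδ1 : δ ≤ 1 := min_le_right _ _
  set x : ℝ := (2 : ℝ) ^ (-(1 / 5 : ℝ)) with hxdef
  have hx0 : 0 < x := Real.rpow_pos_of_pos h2 _
  -- the two power identities
  have hcrit : (2 : ℝ) ^ ((1 / 5 : ℝ) * ((1 : ℤ) : ℝ)) * |x| = 1 := by
    rw [abs_of_pos hx0, hxdef, ← Real.rpow_add h2]
    norm_num
  have hsteady : -((2 : ℝ) ^ ((4 / 5 : ℝ) * ((1 : ℤ) : ℝ))) * x + (2 : ℝ) ^ (((1 : ℤ) : ℝ)) * x * x = 0 := by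
    have e1 : (2 : ℝ) ^ ((4 / 5 : ℝ) * ((1 : ℤ) : ℝ)) * x = (2 : ℝ) ^ ((3 / 5 : ℝ)) := by
      rw [hxdef, ← Real.rpow_add h2]; norm_num
    have e2 : (2 : ℝ) ^ (((1 : ℤ) : ℝ)) * x * x = (2 : ℝ) ^ ((3 / 5 : ℝ)) := by
      rw [hxdef, ← Real.rpow_add h2, ← Real.rpow_add h2]; norm_num
    rw [neg_mul, e1, e2]; ring
  -- window and horizon
  set L : ℝ := (|C| + 1) / (δ ^ 2 * (2 : ℝ) ^ ((4 / 5 : ℝ))) with hLdef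
  have hp45 : 0 < (2 : ℝ) ^ ((4 / 5 : ℝ)) := Real.rpow_pos_of_pos h2 _
  have hL : 0 < L := by positivity
  have key := hC δ hδ (min_le_left _ _) (2 + L) (steadyX 2) (by linarith)
    (fun i n t _ => by
      have hc := hasDerivAt_const t (steadyX 2 i n t)
      refine hc.congr_deriv ?_
      rw [circuitRHS_selfCoeff]
      by_cases hn : n = 1
      · subst hn; simp only [steadyX, if_true]; rw [← hxdef]; exact hsteady.symm
      · simp [steadyX, hn])
    (fun i n t hn => by simp [steadyX, show n ≠ 1 by omega])
    (fun T' _ => ⟨(2 : ℝ) ^ ((4 : ℝ) * ((1 : ℤ) : ℝ)) * |x|, fun i n t _ => by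
      by_cases hn : n = 1
      · subst hn; simp only [steadyX, if_true]; rfl
      · simp only [steadyX, hn, if_false, abs_zero, mul_zero]; positivity⟩)
    (fun t _ i n => by
      by_cases hn : n = 1
      · subst hn; simp only [steadyX, if_true]; rw [← hxdef, hcrit]
      · simp [steadyX, hn])
    0 le_rfl 1 (1 + L) one_pos (by linarith) (by linarith)
    (fun i t _ => by simp only [steadyX, show (0 : ℤ) ≠ 1 by omega, if_false, abs_zero, mul_zero]; exact hδ.le)
    (fun t _ => ⟨0, 1, by norm_num, by simp only [steadyX, if_true]; rw [← hxdef, hcrit]; exact hδ1⟩)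
  -- key : δ ^ 2 * 2 ^ ((4/5) * (↑0 + 1)) * ((1 + L) - 1) ≤ C, i.e. |C| + 1 ≤ C
  have hval : δ ^ 2 * (2 : ℝ) ^ ((4 / 5 : ℝ) * (((0 : ℤ) : ℝ) + 1)) * ((1 + L) - 1) = |C| + 1 := by
    have : ((4 / 5 : ℝ) * (((0 : ℤ) : ℝ) + 1)) = (4 / 5 : ℝ) := by norm_num
    rw [this, hLdef]
    field_simp
    ring
  rw [hval] at key
  linarith [le_abs_self C]

end Summit.NavierStokesRegularity.NavierStokesRegularity.Theorems.CircuitTrace.Negative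

end
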